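import Summits.CriticalPhenomena.SAWScalingLimit.Theorems.SAWDefectDecoherenceBoundaryClosureRGateMassLawsReduction
import HarnessLib

/-!
# Crux `BoundaryClosureR` (stmt-CriticalPhenomena-14004), line `pick-half-plane`:
root-arm divergence (b) of `stub_gateMassLaws` follows from a POINTWISE harmonic arm bound

Landing target:
`Summits/CriticalPhenomena/SAWScalingLimit/Theorems/SAWDefectDecoherenceBoundaryClosureRGateMassLawsArm.lean`
(`--supports stmt-CriticalPhenomena-14004`).

`GateMassLaws` (b) asks that the arrival mass on the root's own flat piece, east of the root `x` at
macroscopic distances `t ∈ (η, r/2)`, in units of `Z_δ(b_δ)/δ`, exceed any `A` for `η` small.  The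
conjectural picture is POINTWISE: `Z_δ(e'_t)/Z_δ(b_δ) → c·t^{-5/4}` (boundary two-point kernel at a
simple pole).  Here we show that already the much weaker, exponent-light pointwise HARMONIC ARM BOUND
`t · Z_δ(e'_t) ≥ κ Z_δ(b_δ)` (`κ > 0`; for every `η > 0` eventually in `δ`, for the floor mid-edges
`e'_t` of the root row in `ball x (r/2)` at abscissa `t > η` east of `x`) implies (b): the arm sum
dominates `κ Z_δ(b_δ) ∫_η dt/t = +∞`.

* `§9` `log_le_sum_mul_inv`: the harmonic Riemann sum `Σ_{i<a} δ/(τ + δ i) ≥ log((τ + δ a)/τ)`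
  (antitone sum–integral comparison);
* `§10` `armDivergence_of_harmonic_at` (one mesh) and `armDivergence_of_harmonic` (eventually,
  `∀ A ∃ η`): the harmonic arm bound implies (b) verbatim, for ARBITRARY nonnegative weights;
* the glue with the density law (a) of the reshaped stub `stub_flatMassLaws` (skeleton r3) is the
  sibling file `…FlatMassLaws.lean`.

What remains OPEN of the stub: the pointwise laws (two-sided comparability on the flat pieces, and
the harmonic arm bound (b*)) — lattice boundary-Harnack statements for the critical self-avoiding walk.
Sources: H. Duminil-Copin, S. Smirnov, Ann. of Math. 175 (2012), §3.
-/

noncomputable section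

open scoped BigOperators Topology
open Filter Set
open Literature.Probability.LatticeModels (HexVertex hexGraph hexCenter Site)
open Literature.Probability.RandomPlanarGeometry
open Literature.Probability.RandomPlanarGeometry.SAW

namespace Summit.CriticalPhenomena.SAWScalingLimit.Theorems.PickHalfPlane.GateMass

/-! ### 9. The harmonic Riemann sum -/

/-- **Harmonic Riemann sum**: for `τ, δ > 0`, `log((τ + δ a)/τ) ≤ Σ_{i<a} δ (δ i + τ)⁻¹` (the
function `u ↦ δ (δ u + τ)⁻¹` is antitone and its integral over `[0, a]` is the left side). [folklore] -/
theorem log_le_sum_mul_inv {τ δ : ℝ} (hτ : 0 < τ) (hδ : 0 < δ) (a : ℕ) :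
    Real.log ((δ * a + τ) / τ) ≤ ∑ i ∈ Finset.range a, δ * (δ * (i : ℝ) + τ)⁻¹ := by
  set f : ℝ → ℝ := fun u => δ * (δ * u + τ)⁻¹ with hf
  have hanti : AntitoneOn f (Set.Icc 0 (0 + (a : ℝ))) := by
    intro u hu v _ huv
    simp only [hf]
    have hu0 : 0 ≤ u := hu.1
    refine mul_le_mul_of_nonneg_left ?_ hδ.le
    exact inv_anti₀ (by positivity) (by nlinarith)
  have key := hanti.integral_le_sum
  simp only [zero_add] at key
  have hint : ∫ u in (0 : ℝ)..(a : ℝ), f u = Real.log ((δ * a + τ) / τ) := by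
    simp only [hf]
    rw [intervalIntegral.integral_const_mul, ← smul_eq_mul]
    have h2 : δ • ∫ u in (0 : ℝ)..(a : ℝ), (δ * u + τ)⁻¹ = ∫ x in δ * 0 + τ..δ * a + τ, x⁻¹ :=
      intervalIntegral.smul_integral_comp_mul_add (fun x => x⁻¹) δ τ
    rw [h2, mul_zero, zero_add, integral_inv_of_pos hτ (by positivity)]
  rw [hint] at key
  exact key

/-! ### 10. Reduction of root-arm divergence (b) to the POINTWISE harmonic arm bound -/

/-- **Harmonic arm bound ⟹ arm divergence, at one mesh.**  At a mesh `0 < δ ≤ η ≤ r/16`: if the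
lattice pin holds at `x` (radius `r`), the floor line of the threshold row `m` is within `r/4` of the
height of `x`, and every floor mid-edge `e'` of the row `m` with scaled midpoint in `ball x (r/2)` at
abscissa `t = re(δ·mid e') - re x > η` satisfies `κ Z_b ≤ t · Z(e')` (`Z ≥ 0`, `Z_b ≥ 0`, `κ > 0`),
then `κ log(r/(16η)) Z_b ≤ δ Σ_{e' ∈ ∂Λ, δ·mid e' ∈ ball x (r/2), re x + η < re(δ·mid e')} Z(e')`.
[cite: DuminilCopinSmirnov2012, §3 (the boundary part α of the strip)] -/
theorem armDivergence_of_harmonic_at {Λ : Finset HexVertex} {m : ℤ} {δ r η κ Zb : ℝ} {x : ℂ}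
    {Z : Sym2 HexVertex → ℝ} (hδ : 0 < δ) (hδη : δ ≤ η) (hη : η ≤ r / 16) (hr : 0 < r) (hκ : 0 < κ)
    (hpin : ∀ v : HexVertex, (δ : ℂ) * hexCenter v ∈ Metric.ball x r → (v ∈ Λ ↔ m ≤ v.1 1))
    (hheight : |δ * (m : ℝ) * (Real.sqrt 3 / 2) - x.im| < r / 4)
    (hZ : ∀ e, 0 ≤ Z e) (hZb : 0 ≤ Zb)
    (hpt : ∀ k : ℤ,
      (δ : ℂ) * hexMidpoint s((((![k, m - 1] : Site 2)), (1 : Fin 2)), ((![k, m] : Site 2), (0 : Fin 2)))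
          ∈ Metric.ball x (r / 2) →
        η < ((δ : ℂ) * hexMidpoint
          s((((![k, m - 1] : Site 2)), (1 : Fin 2)), ((![k, m] : Site 2), (0 : Fin 2)))).re - x.re →
        κ * Zb ≤ (((δ : ℂ) * hexMidpoint
            s((((![k, m - 1] : Site 2)), (1 : Fin 2)), ((![k, m] : Site 2), (0 : Fin 2)))).re - x.re) *
          Z s((((![k, m - 1] : Site 2)), (1 : Fin 2)), ((![k, m] : Site 2), (0 : Fin 2)))) :
    κ * Real.log (r / (16 * η)) * Zb ≤ δ * ∑ᶠ e' ∈ {e' : Sym2 HexVertex | e' ∈ hexDomainBoundary Λ ∧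
        (δ : ℂ) * hexMidpoint e' ∈ Metric.ball x (r / 2) ∧ x.re + η < ((δ : ℂ) * hexMidpoint e').re},
        Z e' := by
  have hη0 : 0 < η := lt_of_lt_of_le hδ hδη
  -- abbreviations
  set fe : ℤ → Sym2 HexVertex := fun k =>
    s((((![k, m - 1] : Site 2)), (1 : Fin 2)), ((![k, m] : Site 2), (0 : Fin 2))) with hfe
  set S : Set ℂ := {z : ℂ | z ∈ Metric.ball x (r / 2) ∧ x.re + η < z.re} with hSdef
  have hS : ∀ z ∈ S, dist z x + δ / 2 < r := by
    intro z hz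
    have h1 : dist z x < r / 2 := hz.1
    linarith
  -- the window as an integer window
  have hW : {e' : Sym2 HexVertex | e' ∈ hexDomainBoundary Λ ∧
      (δ : ℂ) * hexMidpoint e' ∈ Metric.ball x (r / 2) ∧ x.re + η < ((δ : ℂ) * hexMidpoint e').re} =
      {e' : Sym2 HexVertex | e' ∈ hexDomainBoundary Λ ∧ (δ : ℂ) * hexMidpoint e' ∈ S} := by
    ext e'; simp only [Set.mem_setOf_eq, hSdef]
  set K : Set ℤ := {k : ℤ | (δ : ℂ) * hexMidpoint (fe k) ∈ S} with hK
  have hsum : ∑ᶠ e' ∈ {e' : Sym2 HexVertex | e' ∈ hexDomainBoundary Λ ∧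
      (δ : ℂ) * hexMidpoint e' ∈ Metric.ball x (r / 2) ∧ x.re + η < ((δ : ℂ) * hexMidpoint e').re},
      Z e' = ∑ᶠ k ∈ K, Z (fe k) := by
    rw [hW, boundaryWindow_eq_image (S := S) hδ.le hpin hS,
      finsum_mem_image (floorEdge_injective m).injOn]
  have hKfin : K.Finite := finite_intWindow (S := S) hδ.le hpin hS
  rw [hsum, finsum_mem_eq_finite_toFinset_sum _ hKfin]
  -- real and imaginary parts of the scaled floor midpoints
  set sδ : ℝ := (m : ℝ) / 2 + 1 / 2 with hsδ
  have hre : ∀ k : ℤ, ((δ : ℂ) * hexMidpoint (fe k)).re = δ * (k + sδ) := by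
    intro k
    rw [Complex.mul_re, Complex.ofReal_re, Complex.ofReal_im, zero_mul, sub_zero, hfe,
      re_hexMidpoint_floorEdge', hsδ]
    ring
  have him : ∀ k : ℤ, ((δ : ℂ) * hexMidpoint (fe k)).im = δ * (m : ℝ) * (Real.sqrt 3 / 2) := by
    intro k
    rw [Complex.mul_im, Complex.ofReal_re, Complex.ofReal_im, zero_mul, add_zero, hfe,
      im_hexMidpoint_floorEdge']
    ring
  -- the first column east of `re x + η` and the number of columns up to `re x + r/4`
  set k₀ : ℤ := ⌊(x.re + η) / δ - sδ⌋ + 1 with hk₀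
  set τ : ℝ := δ * ((k₀ : ℝ) + sδ) - x.re with hτ
  have hτη : η < τ := by
    have h1 := Int.lt_floor_add_one ((x.re + η) / δ - sδ)
    have h2 : (x.re + η) / δ - sδ < (k₀ : ℝ) := by rw [hk₀]; push_cast; linarith
    rw [sub_lt_iff_lt_add, div_lt_iff₀ hδ] at h2
    rw [hτ]; nlinarith
  have hτη' : τ ≤ η + δ := by
    have h1 := Int.floor_le ((x.re + η) / δ - sδ)
    have h2 : (k₀ : ℝ) - 1 ≤ (x.re + η) / δ - sδ := by rw [hk₀]; push_cast; linarith
    rw [le_sub_iff_add_le, le_div_iff₀ hδ] at h2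
    rw [hτ]; nlinarith
  have hτ0 : 0 < τ := lt_trans hη0 hτη
  have hτr : τ < r / 4 := by linarith
  set a : ℕ := ⌊(r / 4 - τ) / δ⌋₊ with ha
  have ha1 : τ + δ * (a : ℝ) ≤ r / 4 := by
    have h1 : (a : ℝ) ≤ (r / 4 - τ) / δ := Nat.floor_le (by rw [le_div_iff₀ hδ]; linarith)
    rw [le_div_iff₀ hδ] at h1
    linarith
  have ha2 : r / 4 - δ < τ + δ * (a : ℝ) := by
    have h1 : (r / 4 - τ) / δ < (a : ℝ) + 1 := Nat.lt_floor_add_one _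
    rw [div_lt_iff₀ hδ] at h1
    linarith
  -- the consecutive columns `k₀, …, k₀ + a - 1` lie in the window
  have ht : ∀ i : ℕ, ((δ : ℂ) * hexMidpoint (fe (k₀ + i))).re - x.re = τ + δ * (i : ℝ) := by
    intro i; rw [hre, hτ]; push_cast; ring
  have hmemK : ∀ i ∈ Finset.range a, k₀ + (i : ℤ) ∈ hKfin.toFinset := by
    intro i hi
    rw [Finset.mem_range] at hi
    have hi' : (i : ℝ) + 1 ≤ a := by exact_mod_cast hi
    have hti : τ + δ * (i : ℝ) ≤ r / 4 := by nlinarith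
    rw [Set.Finite.mem_toFinset, hK, Set.mem_setOf_eq, hSdef, Set.mem_setOf_eq, Metric.mem_ball]
    refine ⟨?_, ?_⟩
    · rw [Complex.dist_eq, Complex.norm_def, Complex.normSq_apply, Complex.sub_re, Complex.sub_im,
        him]
      have e1 : ((δ : ℂ) * hexMidpoint (fe (k₀ + ↑i))).re - x.re = τ + δ * (i : ℝ) := ht i
      rw [e1]
      have h2 : (τ + δ * (i : ℝ)) * (τ + δ * (i : ℝ)) +
          (δ * (m : ℝ) * (Real.sqrt 3 / 2) - x.im) * (δ * (m : ℝ) * (Real.sqrt 3 / 2) - x.im) <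
            (r / 2) * (r / 2) := by
        rw [abs_lt] at hheight
        have : 0 ≤ τ + δ * (i : ℝ) := by positivity
        nlinarith
      calc Real.sqrt ((τ + δ * (i : ℝ)) * (τ + δ * (i : ℝ)) +
            (δ * (m : ℝ) * (Real.sqrt 3 / 2) - x.im) * (δ * (m : ℝ) * (Real.sqrt 3 / 2) - x.im))
          < Real.sqrt ((r / 2) * (r / 2)) :=
            Real.sqrt_lt_sqrt (add_nonneg (mul_self_nonneg _) (mul_self_nonneg _)) h2
        _ = r / 2 := Real.sqrt_mul_self (by positivity)
    · have e1 := ht i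
      have : 0 ≤ δ * (i : ℝ) := by positivity
      linarith
  -- the pointwise bound on these columns
  have hcol : ∀ i ∈ Finset.range a, κ * Zb * (τ + δ * (i : ℝ))⁻¹ ≤ Z (fe (k₀ + i)) := by
    intro i hi
    have hk := hmemK i hi
    rw [Set.Finite.mem_toFinset, hK, Set.mem_setOf_eq, hSdef, Set.mem_setOf_eq] at hk
    have hpos : 0 < τ + δ * (i : ℝ) := by positivity
    have h1 := hpt (k₀ + i) hk.1 (by
      rw [ht i]; linarith [mul_nonneg hδ.le (Nat.cast_nonneg (α := ℝ) i)])
    rw [ht i] at h1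
    rw [mul_inv_le_iff₀ hpos]
    linarith
  -- summing up
  have hJ : (Finset.range a).image (fun i : ℕ => k₀ + (i : ℤ)) ⊆ hKfin.toFinset := by
    intro k hk
    rw [Finset.mem_image] at hk
    obtain ⟨i, hi, rfl⟩ := hk
    exact hmemK i hi
  have hinj : Set.InjOn (fun i : ℕ => k₀ + (i : ℤ)) (Finset.range a) := by
    intro i _ j _ h
    have : (i : ℤ) = j := by simpa using h
    exact_mod_cast this
  have hlog : Real.log (r / (16 * η)) ≤ Real.log ((δ * a + τ) / τ) := by
    refine Real.log_le_log (by positivity) ?_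
    rw [div_le_div_iff₀ (by positivity) hτ0]
    nlinarith
  calc κ * Real.log (r / (16 * η)) * Zb
      ≤ κ * Real.log ((δ * a + τ) / τ) * Zb := by
        refine mul_le_mul_of_nonneg_right (mul_le_mul_of_nonneg_left hlog hκ.le) hZb
    _ ≤ κ * (∑ i ∈ Finset.range a, δ * (δ * (i : ℝ) + τ)⁻¹) * Zb := by
        refine mul_le_mul_of_nonneg_right (mul_le_mul_of_nonneg_left
          (log_le_sum_mul_inv hτ0 hδ a) hκ.le) hZb
    _ = δ * ∑ i ∈ Finset.range a, κ * Zb * (τ + δ * (i : ℝ))⁻¹ := by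
        rw [Finset.mul_sum, Finset.sum_mul, Finset.mul_sum]
        refine Finset.sum_congr rfl fun i _ => ?_
        rw [add_comm (δ * (i : ℝ)) τ]; ring
    _ ≤ δ * ∑ i ∈ Finset.range a, Z (fe (k₀ + i)) :=
        mul_le_mul_of_nonneg_left (Finset.sum_le_sum hcol) hδ.le
    _ = δ * ∑ k ∈ (Finset.range a).image (fun i : ℕ => k₀ + (i : ℤ)), Z (fe k) := by
        rw [Finset.sum_image hinj]
    _ ≤ δ * ∑ k ∈ hKfin.toFinset, Z (fe k) :=
        mul_le_mul_of_nonneg_left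
          (Finset.sum_le_sum_of_subset_of_nonneg hJ fun _ _ _ => hZ _) hδ.le

/-- **Harmonic arm bound ⟹ root-arm divergence (b).**  Let the lattice pin hold at the root `x`
(radius `r > 0`) eventually, let the roots `e δ ∈ ∂(Λ δ)` have `δ·mid(e δ) → x`, and let `Z δ ≥ 0`
be any weights.  If for some `κ > 0` and every `η > 0`, eventually, every floor mid-edge
`e' = floorEdge k (m δ)` with scaled midpoint in `ball x (r/2)` at abscissa `t = re(δ·mid e') - re x > η`
satisfies `κ Z δ (b δ) ≤ t · Z δ e'` (the HARMONIC ARM BOUND: `κ` uniform in `η`, the mesh threshold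
not — so that roots converging slowly to `x` are allowed), then `∀ A, ∃ η ∈ (0, r/2)`, eventually
`A Z δ (b δ) ≤ δ Σ_{e' ∈ ∂(Λ δ), δ·mid e' ∈ ball x (r/2), re x + η < re(δ·mid e')} Z δ e'` — verbatim
the conclusion of `GateMassLaws` (b) for the weights `Z δ e' = ‖F_{Λ δ, e δ, x_c, 0}(e')‖`.
[cite: DuminilCopinSmirnov2012, §3 (the boundary part α of the strip)] -/
theorem armDivergence_of_harmonic {Λ : ℝ → Finset HexVertex} {m : ℝ → ℤ} {r : ℝ} {x : ℂ}
    {e b : ℝ → Sym2 HexVertex} {Z : ℝ → Sym2 HexVertex → ℝ} (hr : 0 < r)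
    (hpin : ∀ᶠ δ : ℝ in 𝓝[>] 0, ∀ v : HexVertex,
      (δ : ℂ) * hexCenter v ∈ Metric.ball x r → (v ∈ Λ δ ↔ m δ ≤ v.1 1))
    (he : ∀ᶠ δ : ℝ in 𝓝[>] 0, e δ ∈ hexDomainBoundary (Λ δ))
    (hlim : Tendsto (fun δ : ℝ => (δ : ℂ) * hexMidpoint (e δ)) (𝓝[>] 0) (𝓝 x))
    (hZ : ∀ δ e', 0 ≤ Z δ e')
    (hpt : ∃ κ : ℝ, 0 < κ ∧ ∀ η : ℝ, 0 < η → ∀ᶠ δ : ℝ in 𝓝[>] 0, ∀ k : ℤ,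
      (δ : ℂ) * hexMidpoint s((((![k, m δ - 1] : Site 2)), (1 : Fin 2)), ((![k, m δ] : Site 2), (0 : Fin 2)))
          ∈ Metric.ball x (r / 2) →
        η < ((δ : ℂ) * hexMidpoint
          s((((![k, m δ - 1] : Site 2)), (1 : Fin 2)), ((![k, m δ] : Site 2), (0 : Fin 2)))).re - x.re →
        κ * Z δ (b δ) ≤ (((δ : ℂ) * hexMidpoint
            s((((![k, m δ - 1] : Site 2)), (1 : Fin 2)), ((![k, m δ] : Site 2), (0 : Fin 2)))).re - x.re) *
          Z δ s((((![k, m δ - 1] : Site 2)), (1 : Fin 2)), ((![k, m δ] : Site 2), (0 : Fin 2)))) :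
    ∀ A : ℝ, ∃ η : ℝ, 0 < η ∧ η < r / 2 ∧ ∀ᶠ δ : ℝ in 𝓝[>] 0,
      A * Z δ (b δ) ≤ δ * ∑ᶠ e' ∈ {e' : Sym2 HexVertex | e' ∈ hexDomainBoundary (Λ δ) ∧
          (δ : ℂ) * hexMidpoint e' ∈ Metric.ball x (r / 2) ∧
          x.re + η < ((δ : ℂ) * hexMidpoint e').re}, Z δ e' := by
  obtain ⟨κ, hκ, hptκ⟩ := hpt
  intro A
  -- choose `η` with `κ log(r/(16η)) = max A 0`
  set η : ℝ := r / 16 * Real.exp (-(max A 0 / κ)) with hη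
  have hη0 : 0 < η := by positivity
  have hexp : Real.exp (-(max A 0 / κ)) ≤ 1 := by
    rw [Real.exp_le_one_iff, neg_nonpos]; positivity
  have hη16 : η ≤ r / 16 := by
    rw [hη]; nlinarith
  have hlogη : κ * Real.log (r / (16 * η)) = max A 0 := by
    have : r / (16 * η) = Real.exp (max A 0 / κ) := by
      rw [hη, Real.exp_neg]
      field_simp
    rw [this, Real.log_exp]
    field_simp
  refine ⟨η, hη0, by linarith, ?_⟩
  -- the floor height is eventually within `r/4` of the height of `x`
  have hheight : ∀ᶠ δ : ℝ in 𝓝[>] 0, |δ * (m δ : ℝ) * (Real.sqrt 3 / 2) - x.im| < r / 4 := by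
    have h' : ∀ᶠ δ : ℝ in 𝓝[>] 0, dist (δ * (m δ : ℝ) * (Real.sqrt 3 / 2)) x.im < r / 4 :=
      tendsto_floorHeight hr hpin he hlim (Metric.ball_mem_nhds _ (by positivity))
    filter_upwards [h'] with δ hδ
    rwa [Real.dist_eq] at hδ
  have hsmall : ∀ᶠ δ : ℝ in 𝓝[>] 0, 0 < δ ∧ δ ≤ η := by
    have h1 : ∀ᶠ δ : ℝ in 𝓝[>] 0, δ ∈ Set.Ioc 0 η := Ioc_mem_nhdsGT hη0
    exact h1
  filter_upwards [hpin, hptκ η hη0, hheight, hsmall] with δ hpinδ hptδ hhδ hδ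
  calc A * Z δ (b δ) ≤ max A 0 * Z δ (b δ) := mul_le_mul_of_nonneg_right (le_max_left _ _) (hZ _ _)
    _ = κ * Real.log (r / (16 * η)) * Z δ (b δ) := by rw [hlogη]
    _ ≤ _ := armDivergence_of_harmonic_at hδ.1 hδ.2 hη16 hr hκ hpinδ hhδ (hZ δ) (hZ δ _) hptδ

/-- **Registered sub-goal `stub_gateMassLaws_armReduction`** (crux item stmt-CriticalPhenomena-14004,
line `pick-half-plane`, stub `stub_gateMassLaws`): an all-columns (`t > 0`) arm bound implies the
root-arm divergence (b) of `GateMassLaws`, for arbitrary nonnegative weights — the registered special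
case of `armDivergence_of_harmonic`, whose hypothesis (the bound for `t > η`, eventually, for every
`η > 0`) is the right conjecture (the all-columns form is expected to FAIL for roots `e δ` converging
to `x` slower than `δ^{4/5}`: a column at abscissa `t ≍ δ` then sees the root at distance `λ ≫ δ^{4/5}`,
so `t · Z ≍ δ (λ/δ)^{-5/4} ≪ δ^{5/4} ≍ Z(b δ)` in the conjectural scaling).
[cite: DuminilCopinSmirnov2012, §3 (the boundary part α of the strip)] -/
theorem stub_gateMassLaws_armReduction : ∀ (Λ : ℝ → Finset HexVertex) (m : ℝ → ℤ) (r : ℝ) (x : ℂ) (e b : ℝ → Sym2 HexVertex) (Z : ℝ → Sym2 HexVertex → ℝ), 0 < r → (∀ᶠ δ : ℝ in 𝓝[>] 0, ∀ v : HexVertex, (δ : ℂ) * hexCenter v ∈ Metric.ball x r → (v ∈ Λ δ ↔ m δ ≤ v.1 1)) → (∀ᶠ δ : ℝ in 𝓝[>] 0, e δ ∈ hexDomainBoundary (Λ δ)) → Tendsto (fun δ : ℝ => (δ : ℂ) * hexMidpoint (e δ)) (𝓝[>] 0) (𝓝 x) → (∀ δ e', 0 ≤ Z δ e') → (∃ κ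 : ℝ, 0 < κ ∧ ∀ᶠ δ : ℝ in 𝓝[>] 0, ∀ k : ℤ, (δ : ℂ) * hexMidpoint s((((![k, m δ - 1] : Site 2)), (1 : Fin 2)), ((![k, m δ] : Site 2), (0 : Fin 2))) ∈ Metric.ball x (r / 2) → 0 < ((δ : ℂ) * hexMidpoint s((((![k, m δ - 1] : Site 2)), (1 : Fin 2)), ((![k, m δ] : Site 2), (0 : Fin 2)))).re - x.re → κ * Z δ (b δ) ≤ (((δ : ℂ) * hexMidpoint s((((![k, m δ - 1] : Site 2)), (1 : Fin 2)), ((![k, m δ] : Site 2), (0 : Fin 2)))).re - x.re) * Z δ s((((![k, m δ - 1] : Site 2)), (1 : Fin 2)), ((![k, m δ] : Site 2), (0 : Fin 2)))) → ∀ A : ℝ, ∃ η : ℝ, 0 < η ∧ η < r / 2 ∧ ∀ᶠ δ : ℝ in 𝓝[>] 0, A * Z δ (b δ) ≤ δ * ∑ᶠ e' ∈ {e' : Sym2 HexVertex | e' ∈ hexDomainBoundary (Λ δ) ∧ (δ : ℂ) * hexMidpoint e' ∈ Metric.ball x (r / 2) ∧ x.re + η < ((δ : ℂ) * hexMidpoint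 e').re}, Z δ e' :=
  fun _ _ _ _ _ _ _ hr hpin he hlim hZ hpt => armDivergence_of_harmonic hr hpin he hlim hZ (by
    obtain ⟨κ, hκ, h⟩ := hpt
    exact ⟨κ, hκ, fun η hη => h.mono fun δ hδ k hk hηt => hδ k hk (hη.trans hηt)⟩)

/-- **Family form of the arm reduction**: under the binders of an admissible family and a pinned flat
root (with `AdmissibleFamily` / `PinnedFlatRoot` and `Z δ = ‖F_{Λ δ, e δ, x_c, 0}‖` written out), the
harmonic arm bound (b*) implies the root-arm divergence (b) of the line's mass-law stub, verbatim.
[cite: DuminilCopinSmirnov2012, §3 (the boundary part α of the strip)] -/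
theorem armDivergence_family
    (hB : ∀ (D : DobrushinDomain) (ρ : ℝ) (Λ : ℝ → Finset HexVertex) (m : ℝ → ℤ)
      (b : ℝ → Sym2 HexVertex),
      (0 < ρ ∧
      D.carrier ∩ Metric.ball (D.pt 1) ρ = {z : ℂ | (D.pt 1).im < z.im} ∩ Metric.ball (D.pt 1) ρ ∧
      (∀ᶠ δ : ℝ in 𝓝[>] 0, hexDomainSimplyConnected (Λ δ) ∧ b δ ∈ hexDomainBoundary (Λ δ) ∧
          (hexGraph.induce ((Λ δ : Finset HexVertex) : Set HexVertex)).Preconnected ∧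
          (∀ v ∈ Λ δ, (δ : ℂ) * hexCenter v ∈ D.carrier) ∧
          (∀ v : HexVertex, (δ : ℂ) * hexCenter v ∈ Metric.ball (D.pt 1) ρ → (v ∈ Λ δ ↔ m δ ≤ v.1 1))) ∧
      (∀ K : Set ℂ, IsCompact K → K ⊆ D.carrier →
          ∀ᶠ δ : ℝ in 𝓝[>] 0, ∀ v : HexVertex, (δ : ℂ) * hexCenter v ∈ K → v ∈ Λ δ) ∧
      Tendsto (fun δ : ℝ => (δ : ℂ) * hexMidpoint (b δ)) (𝓝[>] 0) (𝓝 (D.pt 1))) →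
      ∀ (x : ℂ) (e : ℝ → Sym2 HexVertex) (r : ℝ) (mr : ℝ → ℤ),
      (0 < r ∧
      D.carrier ∩ Metric.ball x r = {z : ℂ | x.im < z.im} ∩ Metric.ball x r ∧
      (∀ᶠ δ : ℝ in 𝓝[>] 0, e δ ∈ hexDomainBoundary (Λ δ) ∧ Nonempty (HexMidEdgeSAW (Λ δ) (e δ) (b δ)) ∧
          (∀ v : HexVertex, (δ : ℂ) * hexCenter v ∈ Metric.ball x r → (v ∈ Λ δ ↔ mr δ ≤ v.1 1))) ∧
      Tendsto (fun δ : ℝ => (δ : ℂ) * hexMidpoint (e δ)) (𝓝[>] 0) (𝓝 x)) → x ≠ D.pt 1 →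
      ∃ κ : ℝ, 0 < κ ∧ ∀ η : ℝ, 0 < η → ∀ᶠ δ : ℝ in 𝓝[>] 0, ∀ k : ℤ,
        (δ : ℂ) * hexMidpoint s((((![k, mr δ - 1] : Site 2)), (1 : Fin 2)), ((![k, mr δ] : Site 2), (0 : Fin 2))) ∈ Metric.ball x (r / 2) →
        η < ((δ : ℂ) * hexMidpoint s((((![k, mr δ - 1] : Site 2)), (1 : Fin 2)), ((![k, mr δ] : Site 2), (0 : Fin 2)))).re - x.re →
        κ * ‖hexParafermionicObservable (Λ δ) (e δ) hexCriticalFugacity 0 (b δ)‖ ≤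
          (((δ : ℂ) * hexMidpoint s((((![k, mr δ - 1] : Site 2)), (1 : Fin 2)), ((![k, mr δ] : Site 2), (0 : Fin 2)))).re - x.re) *
            ‖hexParafermionicObservable (Λ δ) (e δ) hexCriticalFugacity 0 s((((![k, mr δ - 1] : Site 2)), (1 : Fin 2)), ((![k, mr δ] : Site 2), (0 : Fin 2)))‖) :
    ∀ (D : DobrushinDomain) (ρ : ℝ) (Λ : ℝ → Finset HexVertex) (m : ℝ → ℤ)
      (b : ℝ → Sym2 HexVertex),
      (0 < ρ ∧
      D.carrier ∩ Metric.ball (D.pt 1) ρ = {z : ℂ | (D.pt 1).im < z.im} ∩ Metric.ball (D.pt 1) ρ ∧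
      (∀ᶠ δ : ℝ in 𝓝[>] 0, hexDomainSimplyConnected (Λ δ) ∧ b δ ∈ hexDomainBoundary (Λ δ) ∧
          (hexGraph.induce ((Λ δ : Finset HexVertex) : Set HexVertex)).Preconnected ∧
          (∀ v ∈ Λ δ, (δ : ℂ) * hexCenter v ∈ D.carrier) ∧
          (∀ v : HexVertex, (δ : ℂ) * hexCenter v ∈ Metric.ball (D.pt 1) ρ → (v ∈ Λ δ ↔ m δ ≤ v.1 1))) ∧
      (∀ K : Set ℂ, IsCompact K → K ⊆ D.carrier →
          ∀ᶠ δ : ℝ in 𝓝[>] 0, ∀ v : HexVertex, (δ : ℂ) * hexCenter v ∈ K → v ∈ Λ δ) ∧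
      Tendsto (fun δ : ℝ => (δ : ℂ) * hexMidpoint (b δ)) (𝓝[>] 0) (𝓝 (D.pt 1))) →
      ∀ (x : ℂ) (e : ℝ → Sym2 HexVertex) (r : ℝ) (mr : ℝ → ℤ),
      (0 < r ∧
      D.carrier ∩ Metric.ball x r = {z : ℂ | x.im < z.im} ∩ Metric.ball x r ∧
      (∀ᶠ δ : ℝ in 𝓝[>] 0, e δ ∈ hexDomainBoundary (Λ δ) ∧ Nonempty (HexMidEdgeSAW (Λ δ) (e δ) (b δ)) ∧
          (∀ v : HexVertex, (δ : ℂ) * hexCenter v ∈ Metric.ball x r → (v ∈ Λ δ ↔ mr δ ≤ v.1 1))) ∧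
      Tendsto (fun δ : ℝ => (δ : ℂ) * hexMidpoint (e δ)) (𝓝[>] 0) (𝓝 x)) → x ≠ D.pt 1 →
      ∀ A : ℝ, ∃ η : ℝ, 0 < η ∧ η < r / 2 ∧ ∀ᶠ δ : ℝ in 𝓝[>] 0,
        A * ‖hexParafermionicObservable (Λ δ) (e δ) hexCriticalFugacity 0 (b δ)‖ ≤
          δ * ∑ᶠ e' ∈ {e' : Sym2 HexVertex | e' ∈ hexDomainBoundary (Λ δ) ∧
            (δ : ℂ) * hexMidpoint e' ∈ Metric.ball x (r / 2) ∧
            x.re + η < ((δ : ℂ) * hexMidpoint e').re},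
            ‖hexParafermionicObservable (Λ δ) (e δ) hexCriticalFugacity 0 e'‖ := by
  intro D ρ Λ m b hAF x e r mr hPR hx
  have hpinr : ∀ᶠ δ : ℝ in 𝓝[>] 0, ∀ v : HexVertex,
      (δ : ℂ) * hexCenter v ∈ Metric.ball x r → (v ∈ Λ δ ↔ mr δ ≤ v.1 1) :=
    hPR.2.2.1.mono fun δ hδ => hδ.2.2
  have he : ∀ᶠ δ : ℝ in 𝓝[>] 0, e δ ∈ hexDomainBoundary (Λ δ) := hPR.2.2.1.mono fun δ hδ => hδ.1
  exact armDivergence_of_harmonic (Z := fun δ z =>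
      ‖hexParafermionicObservable (Λ δ) (e δ) hexCriticalFugacity 0 z‖) hPR.1 hpinr he hPR.2.2.2
    (fun _ _ => norm_nonneg _) (hB D ρ Λ m b hAF x e r mr hPR hx)

end Summit.CriticalPhenomena.SAWScalingLimit.Theorems.PickHalfPlane.GateMass

end
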